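import Summits.CriticalPhenomena.PercolationContinuityZ3.Theses.PercNearOneGluing
import Literature.Probability.Percolation.PercolationProofs
import Literature.Probability.Percolation.ConditionalPositiveAssociationProofs
import Literature.Probability.Percolation.TwoClusterConditionalAssociationProofs
import Summits.CriticalPhenomena.PercolationContinuityZ3.Theorems.PercNearOneGluingAdditiveGluingGoodPocketMarkov

/-! TTRL-lite variant V1359 of stmt-CriticalPhenomena-4576 -/

namespace Summit.CriticalPhenomena.PercolationContinuityZ3.Theorems

open MeasureTheory Literature.Probability.LatticeModels Literature.Probability.Percolation
open scoped Classical BigOperators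

/-- TTRL-lite variant V1359 of `stub_goodStep` (stmt-CriticalPhenomena-4576): **pocket Markov identity**.
For `o ∈ W` and `a, b ∉ W`, `μ({C(o) = W} ∩ {a ↔ b}) = μ(C(o) = W) · μ(a ↔ b inside Wᶜ)`: on `{C(o) = W}` an
open path from `a ∉ W` never meets `W` (`goodPM_cluster_inter_openConn`), the event `{C(o) = W}` is determined
by the pairs meeting `W` (`goodPM_determinedBy_cluster_eq`) and `{a ↔ b inside Wᶜ}` by the pairs inside `Wᶜ`
(`DCT16.determinedBy_openConnIn`), which are independent under the product measure
(`prodBernoulli_real_inter_of_determinedBy_disjoint`). [folklore; Kozma–Nitzan arXiv:2401.12397 proof of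
Thm 5 p. 14 (spatial Markov property)] -/
theorem stub_goodStep_var1359 :
    ∀ (n : ℕ) (w : Sym2 (Fin n) → unitInterval) (W : Finset (Fin n)) (o a b : Fin n), o ∈ W → a ∉ W →
      b ∉ W →
        (prodBernoulli w).real
            ({ω : BondConfig (Fin n) | openCluster ω o = (W : Set (Fin n))} ∩ openConn a b) =
          (prodBernoulli w).real {ω : BondConfig (Fin n) | openCluster ω o = (W : Set (Fin n))} *
            (prodBernoulli w).real (openConnIn ((W : Set (Fin n))ᶜ) a b) := by
  intro n w W o a b ho ha _
  rw [goodPM_cluster_inter_openConn o a b W ha]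
  -- `{a ↔ b inside Wᶜ}` is determined by the pairs inside `Wᶜ`
  have hK : ((W : Set (Fin n))ᶜ).sym2 ⊆
      (↑(Finset.univ.filter fun e : Sym2 (Fin n) => ∀ x ∈ e, x ∉ W) : Set (Sym2 (Fin n))) := by
    intro e he
    rw [Finset.coe_filter]
    exact ⟨Finset.mem_univ _, fun x hx => Set.mem_sym2_iff_subset.1 he hx⟩
  refine prodBernoulli_real_inter_of_determinedBy_disjoint w ?_ (goodPM_determinedBy_cluster_eq o W ho)
    (Literature.Probability.Percolation.DCT16.determinedBy_openConnIn ((W : Set (Fin n))ᶜ) a b hK)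
    (Set.toFinite _).measurableSet (Set.toFinite _).measurableSet
  -- the pairs meeting `W` and the pairs inside `Wᶜ` are disjoint
  rw [Finset.disjoint_left]
  intro e he he'
  obtain ⟨x, hxW, hxe⟩ := (Finset.mem_filter.1 he).2
  exact (Finset.mem_filter.1 he').2 x hxe hxW

end Summit.CriticalPhenomena.PercolationContinuityZ3.Theorems
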